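import Summits.AtomisticToContinuum.FouriersLaw.Theorems.JunctionLocalityConductanceLowerBoundBulkAbelFloorOfHoelderCorner
import Summits.AtomisticToContinuum.FouriersLaw.Theorems.EmbeddedDrudeMourreAbelThermodynamicLimitOfLowerBound
import Summits.AtomisticToContinuum.FouriersLaw.Theorems.HoelderEscapeProfileFibreCalculus
import Summits.AtomisticToContinuum.FouriersLaw.Theorems.CurrentTiltQuenchSymmetricSetup
import Summits.AtomisticToContinuum.FouriersLaw.Theorems.EmbeddedDrudeMourreNessUnique
import HarnessLib

/-!
# Line `corner-and-regularity` — crux `AbelThermodynamicLimit` (stmt-AtomisticToContinuum-12596) on the BET ROUTE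
# HoelderEscapeProfile: the node from (R) and the route's two POSITIVITY cruxes K1, K2 only

ALTERNATIVE line (crux-strategist seat 12596-s2, 2026-08-17).  The lead's skeleton slot (`Lines/loomis_compact_horizon_witness.lean`
rev 5, stubs (R) = stmt-13416 and CLB = stmt-11749 BY NAME) is NOT touched; this file is published under `Lines/` and attached as
evidence only.

What it records, kernel-checked (sorries ONLY in the three `stub_*`, each an EXISTING filed item BY NAME):

* `stub_uniformAbelianRegularity` := `StaticAbelianSqueeze.UniformAbelianRegularity` (R) = stmt-13416 (load-bearing; open-problem class);
* `stub_localEnergyHalfHoelder` := `HoelderEscapeProfile.LocalEnergyHalfHoelder` K1 = stmt-16008 (the route's rank-2 crux);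
* `stub_cornerNoDip` := `HoelderEscapeProfile.CornerNoDip` K2 = stmt-16009 (rank 3);
* `AbelThermodynamicLimit_of : (R) → K1 → K2 → EmbeddedDrudeMourre.AbelThermodynamicLimit` — REAL proof: K1 ∧ K2 ∧ FibreCalculus
  (stmt-16011, PROVED 2026-08-17 `FibreCalculusSketch.fibreCalculus_proof`) ∧ SymmetricSetup (stmt-11036, PROVED) give a shift-invariant
  bulk Abel FLOOR (`bulkAbelFloor_of_hoelderCorner`, landed: pigeonhole in `k`, no limit, no ceiling needed), hence the open-chain
  Abel floor (A⁻) and, with the lower half of (R), CLB (`conductanceLowerBound_of_hoelderCorner`, landed 12:41Z); then the split glue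
  p127832 `stub_cruxOfRegularityOfLowerBound : (R) → CLB → crux`.
* `fouriersLaw_of_regularity_of_lowerBound : (R) → CLB → FouriersLaw` — NO witness, NO engine, NO route `closes`: (R) alone gives a
  common finite limit `T²·D_N → L` along every steady family (p127832 §2 `exists_regularPair_commonLimit_of_regularity`), CLB gives
  `L > 0`, and the finite-`N` frame is landed (`pinnedChain_exists_isSteadyState`, `nessUnique_proof`, `finiteResponse_of_unique`).
  So the pair {stmt-13416, stmt-11749} is a COMPLETE cone for the summit conjunct on every sharing route.
* `fouriersLaw_of_corner_and_regularity : K1 → K2 → (R) → FouriersLaw` — on the bet route the honest OPEN cone for `FouriersLaw` is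
  {stmt-16008, stmt-16009, stmt-13416}: `AbelSpreadCeiling` (stmt-16010, open-problem class) and `AbelRegularity` (stmt-15384) — which
  `closes` consumes only to manufacture the crux's idle hypothesis witness — are NOT load-bearing once (R) is, because two-sided (R)
  already contains finiteness and convergence of the bulk Abel means at the regular pair (p127891/p132484).

Nothing here is new mathematics; it is the END STATE of the node on the bet route after today's landings (p156938, p157859,
FibreCalculus 12:42Z, HoelderCorner 12:41Z), written so that (i) a lead seated on 12596 for HoelderEscapeProfile holds a line whose
every open stub is a filed, led item and says `blocked-on: stmt-…-13416` at once, and (ii) the tenure planner of HoelderEscapeProfile can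
re-glue `closes` as `K1 → K2 → (R) → FouriersLaw` (three cruxes; 16010/15384/12596 leave the cone).
References: Bonetto–Lebowitz–Rey-Bellet 2000 §5.3 (33), §7; Kundu–Dhar–Narayan 2009; Helfand 1960.
-/

noncomputable section

open MeasureTheory Filter Set
open scoped Topology

namespace Summit.AtomisticToContinuum.FouriersLaw.Cruxes.AbelThermodynamicLimit.CornerAndRegularity

open Literature.MathematicalPhysics.KineticTheory.HeatConduction
open Summit.AtomisticToContinuum.FouriersLaw.Theses

/-! ## The three stubs (existing items BY NAME) -/

/-- **Stub 1 — (R)** `StaticAbelianSqueeze.UniformAbelianRegularity` (stmt-AtomisticToContinuum-13416), the load-bearing stub: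
`N`-uniform `o(N)` slow weight of the open chain's equilibrium total-current autocorrelation. [cite: BonettoLebowitzReyBellet2000, §7] -/
theorem stub_uniformAbelianRegularity : StaticAbelianSqueeze.UniformAbelianRegularity := by
  sorry

/-- **Stub 2 — K1** `HoelderEscapeProfile.LocalEnergyHalfHoelder` (stmt-AtomisticToContinuum-16008): ½-Hölder Abel return of the
site energy. [cite: BonettoLebowitzReyBellet2000, §6.3] -/
theorem stub_localEnergyHalfHoelder : HoelderEscapeProfile.LocalEnergyHalfHoelder := by
  sorry

/-- **Stub 3 — K2** `HoelderEscapeProfile.CornerNoDip` (stmt-AtomisticToContinuum-16009): no dip of the fibred Abelian conductivity at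
`k = 0` on the parabolic scale. [cite: Helfand1960, eq. (3.10)] -/
theorem stub_cornerNoDip : HoelderEscapeProfile.CornerNoDip := by
  sorry

/-! ## Sorry-free glue over landed theorems -/

/-- Route copies of (R) agree definitionally. [folklore] -/
theorem uniformAbelianRegularity_hep_of_sas (h : StaticAbelianSqueeze.UniformAbelianRegularity) :
    HoelderEscapeProfile.UniformAbelianRegularity := h

/-- Route copies of CLB agree definitionally. [folklore] -/
theorem conductanceLowerBound_sas_of_hep (h : HoelderEscapeProfile.ConductanceLowerBound) :
    StaticAbelianSqueeze.ConductanceLowerBound := h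

/-- **CLB on the bet route from K1, K2 and (R)** (FibreCalculus and SymmetricSetup are PROVED items; the floor is the pigeonhole corner
bound, the exchange is `conductanceLowerBound_of_abelFloor_and_signedSlowRegularity`). [cite: KunduDharNarayan2009, p. 3] -/
theorem conductanceLowerBound_of_corner_and_regularity
    (hK1 : HoelderEscapeProfile.LocalEnergyHalfHoelder) (hK2 : HoelderEscapeProfile.CornerNoDip)
    (hR : StaticAbelianSqueeze.UniformAbelianRegularity) :
    StaticAbelianSqueeze.ConductanceLowerBound :=
  conductanceLowerBound_sas_of_hep
    (Summit.AtomisticToContinuum.FouriersLaw.Cruxes.ConductanceLowerBound.AbelFloorExchange.conductanceLowerBound_of_hoelderCorner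
      hK1 hK2 Summit.AtomisticToContinuum.FouriersLaw.Theorems.FibreCalculusSketch.fibreCalculus_proof
      Summit.AtomisticToContinuum.FouriersLaw.Theorems.CurrentTiltQuench.hoelderEscapeProfile_symmetricSetup_proof
      (uniformAbelianRegularity_hep_of_sas hR))

/-- **COMPOSITION — the crux BY NAME from the three stubs' statements** ((R) → K1 → K2 → crux), via the landed split glue p127832.
[cite: BonettoLebowitzReyBellet2000, §7 eq. (37)] -/
theorem AbelThermodynamicLimit_of :
    StaticAbelianSqueeze.UniformAbelianRegularity → HoelderEscapeProfile.LocalEnergyHalfHoelder →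
      HoelderEscapeProfile.CornerNoDip → EmbeddedDrudeMourre.AbelThermodynamicLimit :=
  fun hR hK1 hK2 =>
    Summit.AtomisticToContinuum.FouriersLaw.Theorems.AbelThermodynamicLimit.LoomisCompactHorizonWitness.stub_cruxOfRegularityOfLowerBound
      hR (conductanceLowerBound_of_corner_and_regularity hK1 hK2 hR)

/-- The crux BY NAME from the stubs (proof-of-item shape; closed=false only through `sorryAx` in the three stubs). [folklore] -/
theorem AbelThermodynamicLimit_skeleton : EmbeddedDrudeMourre.AbelThermodynamicLimit :=
  AbelThermodynamicLimit_of stub_uniformAbelianRegularity stub_localEnergyHalfHoelder stub_cornerNoDip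

/-- The bet route's copy of the crux (definitionally the same statement). [folklore] -/
theorem hoelderAbelThermodynamicLimit_of :
    StaticAbelianSqueeze.UniformAbelianRegularity → HoelderEscapeProfile.LocalEnergyHalfHoelder →
      HoelderEscapeProfile.CornerNoDip → HoelderEscapeProfile.AbelThermodynamicLimit :=
  fun hR hK1 hK2 => AbelThermodynamicLimit_of hR hK1 hK2

/-! ## Records: the summit conjunct from (R) ∧ CLB directly, and from K1 ∧ K2 ∧ (R) on the bet route -/

/-- **`FouriersLaw` from (R) and CLB alone** — no Green–Kubo witness, no route engine, no `closes`: (R) pins a finite common limit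
`T²·D_N → L` along every steady family (regular pair + fixed-frequency matching + anchored DC limit, all landed), CLB makes `L > 0`,
and the finite-`N` frame (steady states exist, are unique, respond linearly) is landed. [cite: BonettoLebowitzReyBellet2000, §5.3 eq. (33)] -/
theorem fouriersLaw_of_regularity_of_lowerBound
    (hR : StaticAbelianSqueeze.UniformAbelianRegularity) (hCLB : StaticAbelianSqueeze.ConductanceLowerBound) :
    _root_.FouriersLaw := by
  classical
  intro ω₂ lam β γ hω hl hβ hγ
  have hU := Summit.AtomisticToContinuum.FouriersLaw.Theorems.nessUnique_proof ω₂ lam β γ hω hl hβ hγ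
  refine ⟨fun N T_L T_R hL hRt => ?_, ?_⟩
  · obtain ⟨μ, hμ⟩ := pinnedChain_exists_isSteadyState hω hl hβ hγ N hL hRt
    exact ⟨μ, hμ, fun ν hν => hU N T_L T_R hL hRt ν μ hν hμ⟩
  · have key : ∀ T : ℝ, 0 < T → ∃ κ : ℝ, 0 < κ ∧
        ∀ (μ : (N : ℕ) → ℝ → ℝ → Measure (PhaseSpace N)) (Dn : ℕ → ℝ),
          (∀ (N : ℕ) (T_L T_R : ℝ), 0 < T_L → 0 < T_R →
            (pinnedChain ω₂ lam β γ).IsSteadyState N T_L T_R (μ N T_L T_R)) →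
          (∀ N : ℕ, Tendsto (fun δ : ℝ =>
              (pinnedChain ω₂ lam β γ).totalCurrent (μ N (T + δ / 2) (T - δ / 2)) / δ)
            (nhdsWithin 0 {(0 : ℝ)}ᶜ) (𝓝 (Dn N))) →
          Tendsto Dn atTop (𝓝 κ) := by
      intro T hT
      obtain ⟨μT, D, L, -, -, -, -, -, -, -, hKubo⟩ :=
        Summit.AtomisticToContinuum.FouriersLaw.Theorems.AbelThermodynamicLimit.LoomisCompactHorizonWitness.exists_regularPair_commonLimit_of_regularity
          hR ω₂ lam β γ hω hl hβ hγ hU T hT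
      obtain ⟨μc, Dc, hμc, hDc⟩ :=
        Summit.AtomisticToContinuum.FouriersLaw.Theorems.AbelThermodynamicLimit.LoomisCompactHorizonWitness.exists_steadyFamily_response
          ω₂ lam β γ hω hl hβ hγ hU T hT
      obtain ⟨c, hc, N₁, hN₁⟩ := hCLB ω₂ lam β γ hω hl hβ hγ hU μc hμc T hT Dc hDc
      have hT2pos : 0 < T ^ 2 := pow_pos hT 2
      have hLpos : 0 < L := by
        have h1 : T ^ 2 * c ≤ L := by
          refine ge_of_tendsto (hKubo μc Dc hμc hDc) ?_
          filter_upwards [eventually_ge_atTop N₁] with N hN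
          exact mul_le_mul_of_nonneg_left (hN₁ N hN) hT2pos.le
        exact lt_of_lt_of_le (mul_pos hT2pos hc) h1
      refine ⟨(T ^ 2)⁻¹ * L, mul_pos (inv_pos.2 hT2pos) hLpos, fun μ Dn hμ hDn => ?_⟩
      have := (hKubo μ Dn hμ hDn).const_mul ((T ^ 2)⁻¹)
      simpa [← mul_assoc, inv_mul_cancel₀ hT2pos.ne'] using this
    choose κf hκf using key
    refine ⟨fun T => if h : 0 < T then κf T h else 1, fun T hT => ?_, fun μ hμ T hT => ?_⟩
    · simp only [dif_pos hT]
      exact (hκf T hT).1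
    · have hD := Summit.AtomisticToContinuum.FouriersLaw.Theorems.FourierGreenKubo.finiteResponse_of_unique
        ω₂ lam β γ hω hl hβ hγ hU μ hμ T hT
      choose Dn hDn using hD
      refine ⟨Dn, hDn, ?_⟩
      simp only [dif_pos hT]
      exact (hκf T hT).2 μ Dn hμ hDn

/-- **`FouriersLaw` on the bet route from K1, K2 and (R)**: the honest open cone of HoelderEscapeProfile for the summit conjunct is
{stmt-16008, stmt-16009, stmt-13416}; `AbelSpreadCeiling`, `AbelRegularity` and the idle witness hypothesis of the crux are not needed.
[cite: BonettoLebowitzReyBellet2000, §5.3 eq. (33)] -/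
theorem fouriersLaw_of_corner_and_regularity
    (hK1 : HoelderEscapeProfile.LocalEnergyHalfHoelder) (hK2 : HoelderEscapeProfile.CornerNoDip)
    (hR : StaticAbelianSqueeze.UniformAbelianRegularity) : _root_.FouriersLaw :=
  fouriersLaw_of_regularity_of_lowerBound hR (conductanceLowerBound_of_corner_and_regularity hK1 hK2 hR)

end Summit.AtomisticToContinuum.FouriersLaw.Cruxes.AbelThermodynamicLimit.CornerAndRegularity

end
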